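import Mathlib.GroupTheory.QuotientGroup.Basic
import Mathlib.FieldTheory.Perfect
import Literature.NumberTheory.GaloisRepresentations.WeilGroup
import Literature.NumberTheory.GaloisRepresentations.WeilDeligneRep
import Literature.NumberTheory.GaloisRepresentations.LocalClassFieldTheory
import HarnessLib

-- provenance: harness21/H21/H21/Statements/Lang/LocalGalois.lean @ a042e98 (interim HEAD d8f2665); M5 mechanical rewrite
/-!
# Langlands family (`lang`): the local Galois side — Weil group, Weil–Deligne representations,
local class field theory (statements **lang.S11**, **lang.S08**)

Let `F` be a non-archimedean local field (`[IsNonarchimedeanLocalField F]`, Mathlib) with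
absolute Galois group `Γ_F = Field.absoluteGaloisGroup F`, Weil group `W_F = Literature.WeilGroup F`
(prelude item C7), inertia `I_F = WeilGroup.inertia F`, degree `deg : W_F → ℤ`
(arithmetic Frobenius `↦ +1`), norm `‖w‖ = WeilGroup.norm w = q ^ deg w` and residue
cardinality `q = residueFieldCard F`.

* **lang.S11** (Deligne, *Les constantes des équations fonctionnelles des fonctions L*, Antwerp
  II, LNM 349 (1973), §8; Tate, *Number theoretic background*, Corvallis 1979, §4 and (1.4.1)):
  the defining package of the Weil group and of Weil–Deligne representations, restated as facts
  about the H21 objects: `I_F` is open in `W_F`; `W_F` is dense in `Γ_F`; `deg` is surjective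
  with kernel `I_F`, so `W_F ⧸ I_F ≃* ℤ` is generated by a Frobenius
  (`weilGroupQuotientInertiaEquiv`); the Weil–Deligne relation `ρ(w) N ρ(w)⁻¹ = ‖w‖ N`; and
  existence and uniqueness of the Frobenius-semisimplification over an algebraically closed
  field of characteristic zero.
* **lang.S08** (Serre, *Local Fields*, Ch. XIII–XIV; Borel, *Automorphic L-functions*,
  Corvallis 1979, §9): local class field theory — there is a topological isomorphism
  `Fˣ → W_F^ab` sending uniformisers to Frobenius lifts and `𝒪_Fˣ` onto the inertia — stated as
  `Nonempty (LocalArtinData F)` (the hypothesis structure of prelude item C18 bundles exactly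
  this isomorphism, in the direction `W_F →* Fˣ`, with its normalisation), together with the
  `GL₁` case of the local Langlands correspondence (`local_langlands_gl1`) and norm
  functoriality (`localArtin_norm_functorial`).

## Mathlib search

Mathlib (this pin) has `Field.absoluteGaloisGroup`, `QuotientGroup.quotientKerEquivOfSurjective`,
`Module.End.IsSemisimple`, `PerfectField.ofCharZero`, `ContinuousMonoidHom`, but
no Weil group, Weil–Deligne representation or local class field theory (`rg -i 'weil group'`,
`rg -i 'Weil.?Deligne'`, `rg -i 'artin map'` have no hits).  All objects come from the H21
prelude (`Literature.NumberTheory.GaloisRepresentations.WeilGroup`, `Literature.NumberTheory.GaloisRepresentations.WeilDeligneRep`, `Literature.NumberTheory.GaloisRepresentations.LocalArtinData`); nothing here duplicates a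
Mathlib declaration.

## Design choices

* The statements are literal restatements of prelude API and are all proved here
  (`weilGroup_isOpen_inertia` and `weilDeligne_conj` outright; the others from the prelude's
  *named facts*, D-0014, threaded as explicit hypotheses exactly as in
  `Literature.NumberTheory.GaloisRepresentations.WeilGroup` (module docstring, "Downstream
  note"): `hmul : IsFrobPow.mul`, `huniq : IsFrobPow.unique`, `hex : exists_isFrobPow` for the
  degree map (`weilGroup_deg_surjective`, `weilGroup_ker_deg_eq_inertia`,
  `weilGroupQuotientInertiaEquiv`), `continuous_toAbsGalois F` / `denseRange_toAbsGalois F`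
  for `weilGroup_denseRange_toAbsGalois`, `WeilDeligneRep.existsUnique_frobSemisimplification`
  for `weilDeligne_existsUnique_frobSemisimplification`, and `nonempty_localArtinData`,
  `LocalArtinData.recGL1_bijective`, `exists_isCompatible F` for the three **lang.S08**
  statements).  No fact is restated as a second `def … : Prop` here; every hypothesis
  disappears once the corresponding prelude fact is discharged.
* `weilDeligne_conj` is stated in `C` with the scalar `(q : C) ^ deg w`; the real number
  `WeilGroup.norm w = (q : ℝ) ^ deg w` is the same quantity (`WeilGroup.norm_def`), and there is
  no canonical map `ℝ → C`.  Sign convention (`Literature.Prelude.GalRep.WeilGroup`): `deg` of an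
  *arithmetic* Frobenius is `+1`, so a geometric Frobenius `Φ` has `‖Φ‖ = q⁻¹` and
  `ρ(Φ) N ρ(Φ)⁻¹ = q⁻¹ N`, which is Deligne's (8.4.1) / Tate's (4.1.2) convention.
* `weilDeligne_existsUnique_frobSemisimplification`: Deligne §8.6 works over an algebraically
  closed `C` of characteristic zero, but the Jordan–Chevalley decomposition (hence the prelude
  theorem `WeilDeligneRep.existsUnique_frobSemisimplification`) only needs `[PerfectField C]`,
  which follows from `CharZero C` (`PerfectField.ofCharZero`).  We therefore state it for any
  `C` of characteristic zero (a formally stronger statement specialising to the cited one); an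
  `[IsAlgClosed C]` hypothesis would be an unused argument.
* **lang.S08** has no `∃!`: a bare `LocalArtinData F` is not unique (uniqueness needs
  norm-compatibility over all finite `E ⊆ F̄`, not statable without local-field instances on
  intermediate fields; see the prelude module docstring).
-/

noncomputable section

open ValuativeRel Field

namespace Literature.NumberTheory.Automorphic

open GaloisRepresentations.IsNonarchimedeanLocalField GaloisRepresentations.WeilGroup

/-! ## lang.S11: the Weil group -/

section WeilGroup

variable (F : Type*) [Field F] [ValuativeRel F] [TopologicalSpace F] [IsNonarchimedeanLocalField F]

/-- **lang.S11** (Weil group, `I_F` open; Deligne, Antwerp II (LNM 349, 1973), §8 and §2.2.4;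
Tate, Corvallis 1979, (1.4.1)).  The inertia group `I_F` is open in the Weil group `W_F` for
the Weil topology. [cite: Corvallis1979, (1.4.1)] -/
theorem weilGroup_isOpen_inertia : IsOpen (inertia F : Set (GaloisRepresentations.WeilGroup F)) :=
  GaloisRepresentations.WeilGroup.isOpen_inertia F

/-- **lang.S11** (Weil group, density in `Γ_F`; Deligne, Antwerp II (LNM 349, 1973), §8 and
§2.2.4; Tate, Corvallis 1979, (1.4.1)).  The inclusion `W_F ↪ Γ_F = Gal(F̄/F)` is continuous
with dense image.  From the named facts `WeilGroup.continuous_toAbsGalois F`,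
`WeilGroup.denseRange_toAbsGalois F` (hypotheses `hc`, `hd`). [cite: Corvallis1979, (1.4.1)] -/
theorem weilGroup_denseRange_toAbsGalois (hc : GaloisRepresentations.WeilGroup.continuous_toAbsGalois F)
    (hd : GaloisRepresentations.WeilGroup.denseRange_toAbsGalois F) :
    Continuous (toAbsGalois F) ∧ DenseRange (toAbsGalois F) :=
  ⟨hc, hd⟩

/-- **lang.S11** (Weil group, `W_F / I_F = Frob^ℤ`, surjectivity half; Deligne, Antwerp II
(LNM 349, 1973), §2.2.4; Tate, Corvallis 1979, (1.4.1)).  The degree map `deg : W_F → ℤ`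
(`deg (arithmetic Frobenius) = 1`) is surjective: `W_F` contains a Frobenius.  Hypotheses: the
named facts `IsFrobPow.mul`, `IsFrobPow.unique`, `exists_isFrobPow` of `LocalGaloisGroup`
(threaded as in `WeilGroup.deg_surjective`). [cite: Corvallis1979, (1.4.1)] -/
theorem weilGroup_deg_surjective (hmul : GaloisRepresentations.IsFrobPow.mul (F := F))
    (huniq : GaloisRepresentations.IsFrobPow.unique (F := F)) (hex : GaloisRepresentations.exists_isFrobPow (F := F)) :
    Function.Surjective (deg (F := F)) :=
  GaloisRepresentations.WeilGroup.deg_surjective hmul huniq hex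

/-- **lang.S11** (Weil group, `W_F / I_F = Frob^ℤ`, kernel half; Deligne, Antwerp II (LNM 349,
1973), §2.2.4; Tate, Corvallis 1979, (1.4.1)).  The kernel of the degree homomorphism
`degHom : W_F →* Multiplicative ℤ` is exactly the inertia group `I_F`, i.e.
`1 → I_F → W_F → ℤ → 0` is exact (hypotheses `hmul huniq` as for `WeilGroup.degHom`). [cite: Corvallis1979, (1.4.1)] -/
theorem weilGroup_ker_deg_eq_inertia (hmul : GaloisRepresentations.IsFrobPow.mul (F := F))
    (huniq : GaloisRepresentations.IsFrobPow.unique (F := F)) : (degHom F hmul huniq).ker = inertia F := by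
  ext w
  rw [MonoidHom.mem_ker, degHom_apply, ← deg_eq_zero_iff_mem_inertia hmul huniq]
  exact ofAdd_eq_one

/-- **lang.S11** (Weil group, `W_F ⧸ I_F ≃ ℤ` generated by Frobenius; Deligne, Antwerp II
(LNM 349, 1973), §2.2.4; Tate, Corvallis 1979, (1.4.1)).  The isomorphism
`W_F ⧸ I_F ≃* Multiplicative ℤ` induced by `deg` (Mathlib
`QuotientGroup.quotientKerEquivOfSurjective`); the class of an arithmetic Frobenius goes to
the generator `ofAdd 1`.  A hypothesis-taking definition (`hn : absInertia_normal F` making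
`I_F ⊴ W_F` via `WeilGroup.inertia_normal`, and `hmul huniq hex` as `WeilGroup.degHom`,
`WeilGroup.deg_surjective`). [cite: Corvallis1979, (1.4.1)] -/
def weilGroupQuotientInertiaEquiv (hn : GaloisRepresentations.absInertia_normal F) (hmul : GaloisRepresentations.IsFrobPow.mul (F := F))
    (huniq : GaloisRepresentations.IsFrobPow.unique (F := F)) (hex : GaloisRepresentations.exists_isFrobPow (F := F)) :
    haveI := inertia_normal hn
    GaloisRepresentations.WeilGroup F ⧸ inertia F ≃* Multiplicative ℤ :=
  haveI := inertia_normal hn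
  (QuotientGroup.quotientMulEquivOfEq (weilGroup_ker_deg_eq_inertia F hmul huniq)).symm.trans
    (QuotientGroup.quotientKerEquivOfSurjective (degHom F hmul huniq) fun n =>
      (weilGroup_deg_surjective F hmul huniq hex n.toAdd).imp fun _ h => by simp [h])

/-- Unfolding lemma: `weilGroupQuotientInertiaEquiv F _ _ _ ↑w = ofAdd (deg w)`.
Ref: Tate, Corvallis 1979, (1.4.1). [cite: Corvallis1979, (1.4.1)] -/
@[simp]
theorem weilGroupQuotientInertiaEquiv_mk (hn : GaloisRepresentations.absInertia_normal F) (hmul : GaloisRepresentations.IsFrobPow.mul (F := F))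
    (huniq : GaloisRepresentations.IsFrobPow.unique (F := F)) (hex : GaloisRepresentations.exists_isFrobPow (F := F)) (w : GaloisRepresentations.WeilGroup F) :
    haveI := inertia_normal hn
    weilGroupQuotientInertiaEquiv F hn hmul huniq hex (w : GaloisRepresentations.WeilGroup F ⧸ inertia F) =
      Multiplicative.ofAdd (deg w) :=
  rfl

end WeilGroup

/-! ## lang.S11: Weil–Deligne representations -/

section WeilDeligne

variable {F : Type*} [Field F] [ValuativeRel F] [TopologicalSpace F] [IsNonarchimedeanLocalField F]
variable {C : Type*} [Field C] [CharZero C] {V : Type*} [AddCommGroup V] [Module C V]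

/-- **lang.S11** (Weil–Deligne relation `ρ(w) N ρ(w)⁻¹ = ‖w‖ N`; Deligne, Antwerp II (LNM 349,
1973), (8.4.1); Tate, Corvallis 1979, (4.1.2)).  For a Weil–Deligne representation
`r = (ρ, N)` of `W_F` and `w ∈ W_F`,
`ρ(w) ∘ N ∘ ρ(w)⁻¹ = ‖w‖ • N` where `‖w‖ = WeilGroup.norm w = q ^ deg w`
(`WeilGroup.norm_def`; here as the scalar `(q : C) ^ deg w` of `C`).  Sign convention: `deg`
of an *arithmetic* Frobenius is `+1`, so for a geometric Frobenius `Φ` (`deg Φ = -1`,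
`‖Φ‖ = q⁻¹`) this reads `ρ(Φ) N ρ(Φ)⁻¹ = q⁻¹ N`, as in Deligne and Tate.  Derived from the
structure field `WeilDeligneRep.conj_N`. [cite: Corvallis1979, (4.1.2)] -/
theorem weilDeligne_conj (r : GaloisRepresentations.WeilDeligneRep F C V) (w : GaloisRepresentations.WeilGroup F) :
    r.ρ w ∘ₗ r.N ∘ₗ r.ρ w⁻¹ = ((residueFieldCard F : C) ^ deg w) • r.N := by
  have h : r.ρ w ∘ₗ r.ρ w⁻¹ = LinearMap.id := by
    rw [← Module.End.mul_eq_comp, ← map_mul, mul_inv_cancel, map_one, Module.End.one_eq_id]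
  rw [← LinearMap.comp_assoc, r.conj_N w, LinearMap.smul_comp, LinearMap.comp_assoc, h,
    LinearMap.comp_id]

/-- **lang.S11** (Frobenius-semisimplification; Deligne, Antwerp II (LNM 349, 1973), §8.5–8.6;
Tate, Corvallis 1979, (4.1.3)).  Over a field `C` of characteristic zero (in the references:
algebraically closed, e.g. `C = ℂ` or `ℚ̄_ℓ`; only perfectness is needed), every
finite-dimensional Weil–Deligne representation `r = (ρ, N)` has a unique
Frobenius-semisimplification `r^{ss} = (ρ^{ss}, N)`: `ρ^{ss}(w)` is the semisimple part of
`ρ(w)`, `ρ^{ss} = ρ` on inertia, same `N` (`WeilDeligneRep.IsFrobSemisimplificationOf`).  From the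
named fact `WeilDeligneRep.existsUnique_frobSemisimplification` (hypothesis `h`, stated for a
perfect coefficient field; `PerfectField C` from `CharZero C`). [cite: Corvallis1979, (4.1.3)] -/
theorem weilDeligne_existsUnique_frobSemisimplification
    (h : GaloisRepresentations.WeilDeligneRep.existsUnique_frobSemisimplification (F := F) (C := C) (V := V))
    [FiniteDimensional C V] (r : GaloisRepresentations.WeilDeligneRep F C V) :
    ∃! r' : GaloisRepresentations.WeilDeligneRep F C V, r'.IsFrobSemisimplificationOf r :=
  haveI := PerfectField.ofCharZero (K := C)
  h r

end WeilDeligne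

/-! ## lang.S08: local class field theory -/

section LocalClassFieldTheory

universe u v

variable (F : Type u) [Field F] [ValuativeRel F] [TopologicalSpace F] [IsNonarchimedeanLocalField F]

/-- **lang.S08** (local class field theory; Serre, *Local Fields* (1979), Ch. XIII §4,
Thm. 1–2 and Ch. XIV; Borel, *Automorphic L-functions*, Corvallis 1979, §9; Tate, Corvallis
1979, (1.4.1)–(1.4.6)).  For a non-archimedean local field `F` there is a topological
isomorphism `Fˣ → W_F^ab` sending uniformisers to (geometric) Frobenius lifts and `𝒪_Fˣ` onto
the inertia: i.e. there is a local Artin datum `artin : W_F →* Fˣ`, a continuous open quotient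
map with kernel `closure [W_F, W_F]`, `artin(I_F) = 𝒪_Fˣ`, `artin(Φ)` a uniformiser for every
`Φ` with `deg Φ = -1` (`Literature.NumberTheory.GaloisRepresentations.LocalArtinData`).  No uniqueness is asserted.  From the named fact
`Literature.NumberTheory.GaloisRepresentations.nonempty_localArtinData` (hypothesis `h`). [cite: Corvallis1979, §9] -/
theorem local_class_field_theory (h : GaloisRepresentations.nonempty_localArtinData.{u}) : Nonempty (GaloisRepresentations.LocalArtinData F) :=
  h F

variable {F} in
/-- **lang.S08** (local Langlands for `GL₁`, desideratum D1; Borel, *Automorphic L-functions*,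
Corvallis 1979, §9.1; Tate, Corvallis 1979, (1.4.5), (2.1); Langlands, *Problems in the theory
of automorphic forms* (1970), §2).  For any local Artin datum `d`, `χ ↦ χ ∘ artin` is a
bijection between continuous quasi-characters `Fˣ →ₜ* ℂˣ` and continuous characters
`W_F →ₜ* ℂˣ` of the Weil group.  From the named fact `LocalArtinData.recGL1_bijective`
(hypothesis `h`). [cite: Corvallis1979, §9.1] -/
theorem local_langlands_gl1 (h : GaloisRepresentations.LocalArtinData.recGL1_bijective (F := F)) (d : GaloisRepresentations.LocalArtinData F) :
    Function.Bijective d.recGL1 :=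
  h d

/-- **lang.S08** (norm functoriality of the local Artin map; Serre, *Local Fields* (1979),
Ch. XIII §4, Prop. 10; Serre, *Local class field theory* (Cassels–Fröhlich 1967, Ch. VI),
§2.4).  For a finite extension `E/F` of non-archimedean local fields (the valuation of `E`
extending that of `F`, `[ValuativeExtension F E]`) such that restriction `Γ_E → Γ_F` maps
`W_E` into `W_F` (hypothesis `h`, supplied by
`WeilGroup.weilSubgroup_map_absGaloisRestrict_le`), there are local Artin data for `F` and `E`
with `artin_F ∘ res = N_{E/F} ∘ artin_E` (`LocalArtinData.IsCompatible`).  Since uniqueness is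
not part of `LocalArtinData`, this is the existence half of the cited proposition.  From the
named fact `Literature.exists_isCompatible F` (hypothesis `hc`). [cite: CasselsFrohlich1967, Ch. VI] -/
theorem localArtin_norm_functorial (hc : GaloisRepresentations.exists_isCompatible.{u, v} F) (E : Type v) [Field E]
    [ValuativeRel E] [TopologicalSpace E] [IsNonarchimedeanLocalField E] [Algebra F E]
    [FiniteDimensional F E] [ValuativeExtension F E]
    (h : (GaloisRepresentations.weilSubgroup E).map (GaloisRepresentations.absGaloisRestrict F E).toMonoidHom ≤ GaloisRepresentations.weilSubgroup F) :
    ∃ (dF : GaloisRepresentations.LocalArtinData F) (dE : GaloisRepresentations.LocalArtinData E), dF.IsCompatible dE h :=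
  hc E h

end LocalClassFieldTheory

end Literature.NumberTheory.Automorphic
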